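import Summits.AnomalousDissipation.AnomalousDissipation.Theorems.ImpulseGridGridInjectionIdentity

/-!
# Route ImpulseGrid (AnomalousDissipation) — crux `GridThesis`, line `Sketch`: the α-balance

Stub `stub_alphaBalance` (W3) of the checked skeleton of crux item stmt-AnomalousDissipation-1770
(`Summit.AnomalousDissipation.AnomalousDissipation.Theses.ImpulseGrid.GridThesis`).

**The exact modal balance.** For a steady smooth force `f`, a smooth divergence-free Stokes
eigenfield `G` (`ΔG = -λG`), a global Leray–Hopf solution `u` on `T³` with sup-bounded kinetic
energy, and any generalized (Banach) long-time limit `Λ`, the amplitude `a(t) := (G, u(t))`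
satisfies

  `(f,G) Λ⟨a⟩ = νλ Λ⟨a²⟩ - Λ⟨a · T_G(u)⟩`,   `T_G(u)(t) := ∫⟪u(t), (u(t)·∇)G⟫`.

Proof. The time-sliced weak formulation tested with `G`
(`Torus.IsLerayHopfOn.integral_inner_eq_add_setIntegral`, Temam 1984 Ch. III (1.25)) says
`(u(t),G) = (u₀,G) + ∫₀ᵗ φ` for `t > 0`, `φ = Torus.trajFlux ν f u G` integrable on every `(0,T)`;
so `P(t) := (u₀,G) + ∫₀ᵗ φ` is absolutely continuous on `[0,T]` with `P' = φ` a.e. (Lebesgue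
differentiation) and the product rule for absolutely continuous functions
(`AbsolutelyContinuousOnInterval.integral_deriv_mul_eq_sub`) gives
`(u(T),G)² - (u₀,G)² = 2 ∫₀ᵀ φ · (u,G)`. On slices `t ≥ 0` the flux splits,
`φ = T_G(u) + ν (u,ΔG) + (f,G) = T_G(u) - νλ a + (f,G)`; `a` is bounded on `[0,∞)` by the energy,
so the Cesàro means of `φ·a` are `O(1/T)` and `Λ⟨φ·a⟩ = 0`; linearity of `Λ⟨·⟩` on pieces that are
interval integrable on every `[0,T]` finishes (Foias–Manley–Rosa–Temam 2001, Ch. IV §3.1 and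
App. B.2; Doering–Foias 2002 §2).
-/

noncomputable section

-- `Summit.<Summit>.<Problem>` is the tree's mandated summit-side namespace (CONVENTIONS §2); for this
-- single-conjunct summit the two coincide, so the duplicate is deliberate.
set_option linter.dupNamespace false

open MeasureTheory Set Filter Topology
open scoped InnerProductSpace RealInnerProductSpace

namespace Summit.AnomalousDissipation.AnomalousDissipation.Theorems

open Literature.Analysis.FluidPDE Literature.Analysis.FluidPDE.Torus
open Literature.Analysis.FunctionSpaces Literature.Analysis.FunctionSpaces.Torus

namespace AlphaBalance

variable {d : Type*} [Fintype d] [DecidableEq d]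
variable {ν : ℝ} {F u₀ : UnitAddTorus d → EuclideanSpace ℝ d}
  {u : ℝ → UnitAddTorus d → EuclideanSpace ℝ d}

/-- The time-sliced weak formulation as a primitive: for a smooth divergence-free `g` and `t > 0`,
`(u(t), g) = (u₀, g) + ∫₀ᵗ flux` (Temam 1984, Ch. III (1.25);
`Torus.IsLerayHopfOn.integral_inner_eq_add_setIntegral`). [folklore] -/
theorem integral_inner_eq_add_integral_trajFlux (hF : MemLp F 2 volume)
    (hu : IsGlobalLerayHopf ν (fun _ => F) u₀ u) {g : UnitAddTorus d → EuclideanSpace ℝ d}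
    (hg : IsSmooth g) (hdiv : IsDivFree g) {t : ℝ} (ht : 0 < t) :
    ∫ x, ⟪u t x, g x⟫ = (∫ x, ⟪u₀ x, g x⟫) + ∫ τ in (0 : ℝ)..t, trajFlux ν F u g τ := by
  rw [intervalIntegral.integral_of_le ht.le]
  exact (hu t ht).integral_inner_eq_add_setIntegral ht (aestronglyMeasurable_stLift_steady' hF.1 _)
    (lintegral_enorm_sq_steady_lt_top hF t) hg hdiv ⟨ht, le_rfl⟩

/-- **The squared amplitude.** For a smooth divergence-free `g` and `T > 0`,
`(u(T), g)² - (u₀, g)² = 2 ∫₀ᵀ flux · (u, g)`: the primitive `P(t) = (u₀,g) + ∫₀ᵗ flux` is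
absolutely continuous on `[0, T]` with `P' = flux` a.e. (Lebesgue differentiation), equals
`(u(t), g)` on `(0, T]`, and the product rule for absolutely continuous functions
(`AbsolutelyContinuousOnInterval.integral_deriv_mul_eq_sub`) integrates `(P²)' = 2 P P'`.
[folklore] -/
theorem sq_integral_inner_sub_sq (hF : MemLp F 2 volume)
    (hu : IsGlobalLerayHopf ν (fun _ => F) u₀ u) {g : UnitAddTorus d → EuclideanSpace ℝ d}
    (hg : IsSmooth g) (hdiv : IsDivFree g) {T : ℝ} (hT : 0 < T) :
    (∫ x, ⟪u T x, g x⟫) ^ 2 - (∫ x, ⟪u₀ x, g x⟫) ^ 2 =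
      2 * ∫ t in (0 : ℝ)..T, trajFlux ν F u g t * ∫ x, ⟪u t x, g x⟫ := by
  set φ : ℝ → ℝ := trajFlux ν F u g with hφ
  set a₀ : ℝ := ∫ x, ⟪u₀ x, g x⟫ with ha₀
  set P : ℝ → ℝ := fun t => a₀ + ∫ τ in (0 : ℝ)..t, φ τ with hP
  have hφi : IntervalIntegrable φ volume 0 T := hu.intervalIntegrable_trajFlux hF hg le_rfl hT.le
  -- `P` is absolutely continuous on `[0, T]`
  have hPI : AbsolutelyContinuousOnInterval (fun t => ∫ τ in (0 : ℝ)..t, φ τ) 0 T :=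
    hφi.absolutelyContinuousOnInterval_intervalIntegral left_mem_uIcc
  have hconst : AbsolutelyContinuousOnInterval (fun _ : ℝ => a₀) 0 T :=
    (contDiffOn_const (c := a₀)).absolutelyContinuousOnInterval
  have hPac : AbsolutelyContinuousOnInterval P 0 T := hconst.fun_add hPI
  -- values of `P`
  have hPT : P T = ∫ x, ⟪u T x, g x⟫ :=
    (integral_inner_eq_add_integral_trajFlux hF hu hg hdiv hT).symm
  have hP0 : P 0 = a₀ := by
    show a₀ + ∫ τ in (0 : ℝ)..0, φ τ = a₀
    rw [intervalIntegral.integral_same, add_zero]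
  -- the a.e. derivative of `P²`
  have hderiv : ∀ᵐ x, x ∈ uIoc (0 : ℝ) T →
      deriv P x * P x + P x * deriv P x = 2 * (φ x * ∫ y, ⟪u x y, g y⟫) := by
    filter_upwards [hφi.ae_hasDerivAt_integral] with x hx hmem
    rw [uIoc_of_le hT.le] at hmem
    have hmem' : x ∈ uIcc (0 : ℝ) T := by
      rw [uIcc_of_le hT.le]
      exact ⟨hmem.1.le, hmem.2⟩
    have hd : HasDerivAt P (φ x) x := (hx hmem' 0 left_mem_uIcc).const_add a₀
    have hPx : P x = ∫ y, ⟪u x y, g y⟫ :=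
      (integral_inner_eq_add_integral_trajFlux hF hu hg hdiv hmem.1).symm
    rw [hd.deriv, hPx]
    ring
  -- the product rule for the absolutely continuous `P`
  have h2 : ∫ x in (0 : ℝ)..T, 2 * (φ x * ∫ y, ⟪u x y, g y⟫) = P T * P T - P 0 * P 0 := by
    rw [← hPac.integral_deriv_mul_eq_sub hPac]
    exact (intervalIntegral.integral_congr_ae hderiv).symm
  rw [intervalIntegral.integral_const_mul, hPT, hP0] at h2
  rw [sq, sq]
  exact h2.symm

end AlphaBalance

/-- **Stub (W3) of crux `GridThesis`, line `Sketch`: the exact modal balance (α-balance).** For a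
steady smooth force `f`, a smooth divergence-free Stokes eigenfield `G` (`ΔG = −λG`), a global
Leray–Hopf solution with sup-bounded kinetic energy and a Banach mean `Λ`, the amplitude
`a(t) = (G,u(t))` satisfies `(f,G)Λ⟨a⟩ = νλΛ⟨a²⟩ − Λ⟨a·T_G(u)⟩`, `T_G(u) = ∫⟪u,(u·∇)G⟫`:
`(u(T),G)² − (u₀,G)² = 2∫₀ᵀ φ·(u,G)` (`AlphaBalance.sq_integral_inner_sub_sq`) with
`φ = T_G(u) − νλa + (f,G)` on slices `t ≥ 0`; `a` is bounded, so `Λ⟨φ·a⟩ = 0`, and `Λ⟨·⟩` is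
linear on pieces interval integrable on every `[0,T]` (FMRT 2001, Ch. IV §3.1; Doering–Foias 2002,
§2). [folklore] -/
theorem stub_alphaBalance :
    ∀ (Λ : GeneralizedLimit) (ν lam : ℝ) (f G u₀ : UnitAddTorus (Fin 3) → EuclideanSpace ℝ (Fin 3))
      (u : ℝ → UnitAddTorus (Fin 3) → EuclideanSpace ℝ (Fin 3)),
      IsSmooth f → IsSmooth G → IsDivFree G →
      (∀ x, laplacian G x = -(lam • G x)) →
      IsGlobalLerayHopf ν (fun _ => f) u₀ u →
      (∃ C : ℝ, ∀ t : ℝ, 0 ≤ t → kineticEnergy (u t) ≤ C) →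
      (∫ x, ⟪f x, G x⟫) * Λ.longTimeAvg (fun t => ∫ x, ⟪G x, u t x⟫) =
        ν * lam * Λ.longTimeAvg (fun t => (∫ x, ⟪G x, u t x⟫) ^ 2) -
          Λ.longTimeAvg (fun t => (∫ x, ⟪G x, u t x⟫) * ∫ x, ⟪u t x, convect (u t) G x⟫) := by
  intro Λ ν lam f G u₀ u hf hG hGd hΔG hu hE
  obtain ⟨C, hC⟩ := hE
  obtain ⟨K, hK0, hK⟩ := exists_nonneg_forall_norm_le_of_continuous hG.continuous
  have hF2 : MemLp f 2 volume := hf.memLp 2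
  -- the two orientations of the amplitude
  have hab : ∀ t, (∫ x, ⟪G x, u t x⟫) = ∫ x, ⟪u t x, G x⟫ := fun t =>
    integral_congr_ae (ae_of_all _ fun x => real_inner_comm _ _)
  -- the amplitude is bounded on `[0, ∞)`
  obtain ⟨M, hbd⟩ : ∃ M : ℝ, ∀ t : ℝ, 0 ≤ t → |∫ x, ⟪u t x, G x⟫| ≤ M :=
    ⟨_, fun t ht => impulseGrid_abs_integral_inner_le hu hK0 hK hC ht⟩
  -- the Laplacian pairing of an eigenfield
  have hlap : ∀ t, (∫ x, ⟪u t x, laplacian G x⟫) = -lam * ∫ x, ⟪u t x, G x⟫ := fun t => by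
    rw [← integral_const_mul]
    refine integral_congr_ae (ae_of_all _ fun x => ?_)
    show ⟪u t x, laplacian G x⟫ = -lam * ⟪u t x, G x⟫
    rw [hΔG x, inner_neg_right, real_inner_smul_right]
    ring
  -- the flux split on slices `t ≥ 0`, multiplied by the amplitude
  have hsplit : ∀ t : ℝ, 0 ≤ t → trajFlux ν f u G t * (∫ x, ⟪u t x, G x⟫) =
      (∫ x, ⟪G x, u t x⟫) * (∫ x, ⟪u t x, convect (u t) G x⟫) -
        ν * lam * (∫ x, ⟪G x, u t x⟫) ^ 2 + (∫ x, ⟪f x, G x⟫) * ∫ x, ⟪G x, u t x⟫ := by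
    intro t ht
    rw [GridInjection.trajFlux_eq_of_nonneg hF2 hu hG ht, hlap t, hab t]
    ring
  -- interval integrability of the pieces on every `[0, T]`
  have hIa : ∀ T, 0 < T → IntervalIntegrable (fun t => ∫ x, ⟪G x, u t x⟫) volume 0 T :=
    fun T hT => (GridInjection.intervalIntegrable_inner hu hG.continuous hT).congr
      fun t _ => (hab t).symm
  have hIbd : ∀ T, 0 < T →
      ∀ᵐ t ∂(volume.restrict (uIoc (0 : ℝ) T)), ‖∫ x, ⟪G x, u t x⟫‖ ≤ M := by
    intro T hT
    filter_upwards [ae_restrict_mem measurableSet_uIoc] with t ht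
    rw [uIoc_of_le hT.le] at ht
    rw [Real.norm_eq_abs, hab t]
    exact hbd t ht.1.le
  have hIsq : ∀ T, 0 < T → IntervalIntegrable (fun t => (∫ x, ⟪G x, u t x⟫) ^ 2) volume 0 T := by
    intro T hT
    have h1 := (hIa T hT).def'
    have h2 : Integrable (fun t => (∫ x, ⟪G x, u t x⟫) * ∫ x, ⟪G x, u t x⟫)
        (volume.restrict (uIoc 0 T)) :=
      Integrable.bdd_mul h1 (Integrable.aestronglyMeasurable h1) (hIbd T hT)
    exact intervalIntegrable_iff.2 (h2.congr (ae_of_all _ fun t => (sq _).symm))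
  have hIaT : ∀ T, 0 < T → IntervalIntegrable
      (fun t => (∫ x, ⟪G x, u t x⟫) * ∫ x, ⟪u t x, convect (u t) G x⟫) volume 0 T := by
    intro T hT
    have h1 := (hIa T hT).def'
    have h2 := (GridInjection.intervalIntegrable_inner_convect hF2 hu hG hT).def'
    exact intervalIntegrable_iff.2 (Integrable.bdd_mul h2 (Integrable.aestronglyMeasurable h1)
      (hIbd T hT))
  have hI1 : ∀ T, 0 < T → IntervalIntegrable (fun t =>
      (∫ x, ⟪G x, u t x⟫) * (∫ x, ⟪u t x, convect (u t) G x⟫) -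
        ν * lam * (∫ x, ⟪G x, u t x⟫) ^ 2) volume 0 T :=
    fun T hT => (hIaT T hT).sub ((hIsq T hT).const_mul (ν * lam))
  have hI2 : ∀ T, 0 < T →
      IntervalIntegrable (fun t => (∫ x, ⟪f x, G x⟫) * ∫ x, ⟪G x, u t x⟫) volume 0 T :=
    fun T hT => (hIa T hT).const_mul _
  have hI3 : ∀ T, 0 < T →
      IntervalIntegrable (fun t => ν * lam * (∫ x, ⟪G x, u t x⟫) ^ 2) volume 0 T :=
    fun T hT => (hIsq T hT).const_mul _
  -- the Cesàro means of `φ · a` are `O(1/T)`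
  have hces : ∀ T : ℝ, 0 < T → timeMean (fun t => trajFlux ν f u G t * ∫ x, ⟪u t x, G x⟫) T =
      T⁻¹ * (((∫ x, ⟪u T x, G x⟫) ^ 2 - (∫ x, ⟪u₀ x, G x⟫) ^ 2) / 2) := by
    intro T hT
    simp only [timeMean]
    rw [AlphaBalance.sq_integral_inner_sub_sq hF2 hu hG hGd hT]
    ring
  have hlim : Tendsto (timeMean (fun t => trajFlux ν f u G t * ∫ x, ⟪u t x, G x⟫)) atTop
      (𝓝 0) := by
    have h1 : Tendsto (fun T : ℝ => ((M ^ 2 + (∫ x, ⟪u₀ x, G x⟫) ^ 2) / 2) * T⁻¹) atTop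
        (𝓝 0) := by
      have h := tendsto_inv_atTop_zero.const_mul ((M ^ 2 + (∫ x, ⟪u₀ x, G x⟫) ^ 2) / 2)
      rwa [mul_zero] at h
    refine squeeze_zero_norm' ?_ h1
    filter_upwards [eventually_gt_atTop (0 : ℝ)] with T hT
    rw [hces T hT, Real.norm_eq_abs, abs_mul, abs_inv, abs_of_pos hT, mul_comm]
    refine mul_le_mul_of_nonneg_right ?_ (inv_nonneg.2 hT.le)
    have hb := abs_le.1 (hbd T hT.le)
    have hsq : (∫ x, ⟪u T x, G x⟫) ^ 2 ≤ M ^ 2 := sq_le_sq' hb.1 hb.2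
    rw [abs_le]
    constructor <;> nlinarith [sq_nonneg (∫ x, ⟪u T x, G x⟫), sq_nonneg (∫ x, ⟪u₀ x, G x⟫),
      sq_nonneg M]
  have hΛ0 : Λ.longTimeAvg (fun t => trajFlux ν f u G t * ∫ x, ⟪u t x, G x⟫) = 0 :=
    Λ.longTimeAvg_eq_of_tendsto hlim
  -- split `Λ⟨φ · a⟩` by linearity
  have hΛsplit : Λ.longTimeAvg (fun t => trajFlux ν f u G t * ∫ x, ⟪u t x, G x⟫) =
      Λ.longTimeAvg (fun t => (∫ x, ⟪G x, u t x⟫) * ∫ x, ⟪u t x, convect (u t) G x⟫) -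
        ν * lam * Λ.longTimeAvg (fun t => (∫ x, ⟪G x, u t x⟫) ^ 2) +
        (∫ x, ⟪f x, G x⟫) * Λ.longTimeAvg (fun t => ∫ x, ⟪G x, u t x⟫) := by
    rw [Λ.longTimeAvg_congr (fun t ht => hsplit t ht.le), GridInjection.longTimeAvg_add Λ hI1 hI2,
      GridInjection.longTimeAvg_sub Λ hIaT hI3, GridInjection.longTimeAvg_const_mul,
      GridInjection.longTimeAvg_const_mul]
  rw [hΛsplit] at hΛ0
  linarith

end Summit.AnomalousDissipation.AnomalousDissipation.Theorems

end
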